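import Summits.ABC.IUTFork.Thm311RealInd1StripPacketRoomSharpness
import Summits.ABC.IUTFork.Thm311RealInd1StripRadicalUniformizer
import Literature.IUT.LogVolume.PacketMonomialBoxRadical
import Literature.IUT.LogVolume.PacketMonomialBoxCoprime
import HarnessLib

/-!
# [IUTchIII] Thm 3.11 (i) (Ind1)+(Ind2), genuine packet of ANY number of TAME residue-degree-one factors: the orbit of the Θ-region `ι_{i₀}(g)·(R_I)^∼` under any
# factorwise-strip group is CONFINED to the polydisc of radius `p^{−v/E}·∏_{i∈S} p^{1−1/e_i}·∏_{i∉S} p^{1−2/e_i}` when the bits fail off `S` (UNCONDITIONAL) —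
# via the MONOMIAL BOX `(R_I)^∼ = Box` at radical power bases (Literature `PacketMonomialBoxRadical`); this closes the flagged strip of R26

PROOF-ONLY file (abc-iut cell, Cor. 3.12 sub-crew, seat abc-iut-c312-1 = holder of record of the typed [IUTchIII] Thm. 3.11, gen 19; row «R26 =
C:ROOM-SHARPNESS» item (θ3), KEY ROOMSHARP, C LEAD ruling C-R171 (a) ff.; file (κ3)).  TAKES NO SIDE on [IUTchIII] Cor. 3.12.  No definition, no `Prop` fact,
NO `JannsenWingbergMappingClass`: everything UNCONDITIONAL (failing bits = displayed `hfix` binders off `S`).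
SETTING.  Genuine packet `X = ⊗_{i∈I} K_{w_i}`, every factor TAME of residue degree ONE with `e_i ≥ 2`; slot `i₀`, `‖g‖ = p^{−v/E}`; `S ⊆ I` the factors where a bit may
hold (no hypothesis there); off `S` the bit FAILS (`hfix`); `H ≤ Aut_{ℚ_p}(X)` factorwise through the realised strip groups (p554348 §2).
MECHANISM.  (κ1) each `K_{w_i}` has a radical uniformiser `π_i^{e_i} = m_i p` (`Thm311RealInd1StripRadicalUniformizer`), hence the power basis `(π_i^j)_{j<e_i}`
(abc-iut-E-t58 `MonomialBox.exists_basis_eq_pow`); (κ2) `(R_I)^∼` IS the monomial box: `y = Σ_J y_J ⊗_i π_i^{J_i}` with `‖y_J‖·∏ p^{−J_i/e_i} ≤ 1`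
(`MonomialBox.box_of_mem_normalizedPacket_of_radical`, DFT over `∏ μ_{e_i}`); so every `z ∈ ι_{i₀}(g)·(R_I)^∼` is `Σ_J y_J·⊗u_J`, `u_J = (π_i^{J_i})[i₀ ↦ g π_{i₀}^{J_{i₀}}]`,
and for a factorwise-strip `γ` each `γ(⊗u_J) = ⊗δ_i(u_{J,i})` has factor norms `≤ ρ_{J,i}` = the radius of the smallest STRIP-STABLE ball containing `u_{J,i}`
(§1 `exists_stableRadius`: a log-shell ball `p^q·log_p` — strip-stable, p554348 §1 — unless `u_{J,i}` generates a depth-`e` ball `p^q·𝒪`, which is strip-INVARIANT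
when the bit fails (p550084) and must be enlarged to `p^{q−1}·log_p` when it may hold); the GAIN `ρ_{J,i}·p^{t/e_i} ≤ p^{1−1/e_i}` (`i ∈ S`) / `p^{1−2/e_i}` (`i ∉ S`)
is uniform in `J`, whence §2.
* §1 **`exists_stableRadius`** — at one tame place of residue degree one with `e ≥ 2`: for every `t ∈ ℤ` a strip-stable radius `ρ` with
  `p^{−t/e} ≤ ρ ≤ p^{−t/e}·p^{1−1/e−[bit fails]/e}`.
* §2 **`packetHull_orbit_smul_normalizedPacket_subset_polydisc_of_fixesBaseLine_off`** — hull(`H`-orbit of `ι_{i₀}(g)·(R_I)^∼`) ⊆ polydisc(`R′_S`),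
  `R′_S = p^{−v/E}·∏_i p^{1−1/e_i−[i∉S]/e_i}` (UNCONDITIONAL, any `|I|`).  The companion `…MonomialBoxSharpRoom` compares `R′_S` with the container radius:
  `R′_S < R` ⟺ R25 (A) §2's room inequality FAILS — the monomial-floor room inequality is SHARP at EVERY factor count and EVERY residue `r`.
READING (numbers about OUR typed objects; neutral); which value a bit takes is NOT claimed; HONEST SCOPE: unconditional; tame residue-degree-one factors only (the
radical power bases); OUR typings (THE equivariant lift, THE logarithm, factorwise action; F-B28-1 untouched); EVEN degree, WILD, `p = 2`, `f > 1` factors outside;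
equal-AS-TYPED ≠ equal in print; nothing here asserts that abc is proved or refuted; no side taken on [IUTchIII] Cor. 3.12 / [IUTchIV] Thm. 1.10, on (U) vs (P),
or on any author. [claim: Mochizuki2012, status: disputed]; [cite: Mochizuki2012, IUTchIII Thm. 3.11 (i) p. 154; Rmk. 3.9.5 (i) p. 127; Cor. 3.12 Step (xi) p. 183;
IUTchIV Prop. 1.1 p. 9, Prop. 1.2 (ii) pp. 10–11, Prop. 1.4 (i) p. 13]; [cite: DupuyHilado2025, §4.9, §4.12]; [cite: NeukirchANT1999, Ch. II (4.8), (5.5)]. typed ≠ proved.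
-/

set_option autoImplicit false

noncomputable section

open Metric Set Bornology Function Module
open scoped Pointwise TensorProduct NormedField

namespace Summit.ABC.IUTFork.Thm311.Real

open NumberField IsDedekindDomain Literature.NumberTheory.NumberFields Literature.IUT.LogVolume
open Literature.NumberTheory.GaloisRepresentations Literature.NumberTheory.GaloisRepresentations.Ultrametric
open Literature.AnabelianGeometry.AbsoluteAnabelian Literature.IUT.HodgeArakelov
open Literature.IUT.HodgeArakelov.AbsTopMonoids

variable {K : Type} [Field K] [NumberField K] (p : ℕ) [hp : Fact p.Prime]

/-! ## §1 One place: a strip-stable radius with uniform gain for every exponent -/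

/-- **Strip-stable radii with uniform gain (UNCONDITIONAL).**  At a tame place `v` of residue degree one with `e ≥ 2`, let `bit : Prop` record whether the base-line
bit MAY hold (if it fails, `hfix`).  For every `t ∈ ℤ` there is a radius `ρ` with `p^{−t/e} ≤ ρ` (so the ball of radius `ρ` contains every element of norm
`p^{−t/e}`), mapped into itself by the whole realised strip GROUP, and `ρ ≤ p^{−t/e}·p^{1−1/e}` if the bit may hold, `ρ ≤ p^{−t/e}·p^{1−2/e}` if it fails: for `e ∤ t`
the log-shell ball `p^{⌊t/e⌋}·log_p` (p554348 §1; gain `((t mod e) − 1)/e ≤ 1 − 2/e`); for `e ∣ t` the depth-`e` ball `p^{t/e}·𝒪` if the bit fails (strip-INVARIANT,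
p550084; gain `0`) or the log-shell ball `p^{t/e−1}·log_p` if it may hold (gain `1 − 1/e`). [claim: Mochizuki2012, status: disputed]
[cite: Mochizuki2012, IUTchIII Thm. 3.11 (i) p. 154; Rmk. 3.9.5 (i) p. 127] -/
theorem exists_stableRadius (v : HeightOneSpectrum (𝓞 K)) (hv : ((p : ℕ) : 𝓞 K) ∈ v.asIdeal) (hp2 : 2 < p)
    (he : absRamificationIdx p (RescaledCompletion K p v hv) ≤ p - 2) (he2 : 2 ≤ absRamificationIdx p (RescaledCompletion K p v hv))
    (hf : v.asIdeal.inertiaDeg ℤ = 1) (bit : Prop) [Decidable bit]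
    (hfix : ¬ bit → ∀ ψ ∈ ind1StripOf v (galoisLog v),
      RescaledCompletion.of K p v hv (ψ (p : v.adicCompletion K)) - (p : RescaledCompletion K p v hv) ∈
        (p : ℚ_[p]) • logUnits (RescaledCompletion K p v hv))
    (t : ℤ) :
    ∃ ρ : ℝ, (p : ℝ) ^ (-((t : ℝ) / (absRamificationIdx p (RescaledCompletion K p v hv) : ℝ))) ≤ ρ ∧
      (∀ δ ∈ AddSubgroup.closure (G := AddAut (v.adicCompletion K)) (ind1StripOf v (galoisLog v)),
        ∀ y : v.adicCompletion K, ‖RescaledCompletion.of K p v hv y‖ ≤ ρ → ‖RescaledCompletion.of K p v hv (δ y)‖ ≤ ρ) ∧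
      ρ ≤ (p : ℝ) ^ (-((t : ℝ) / (absRamificationIdx p (RescaledCompletion K p v hv) : ℝ)) +
        (1 - 1 / (absRamificationIdx p (RescaledCompletion K p v hv) : ℝ) - if bit then 0 else 1 / (absRamificationIdx p (RescaledCompletion K p v hv) : ℝ))) := by
  set E : ℕ := absRamificationIdx p (RescaledCompletion K p v hv) with hE
  have hP : p.Prime := Fact.out
  have hp0 : (0 : ℝ) < p := by exact_mod_cast hP.pos
  have hp1 : (1 : ℝ) ≤ p := by exact_mod_cast hP.one_lt.le
  have hpQ : (p : ℚ_[p]) ≠ 0 := by exact_mod_cast hP.ne_zero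
  have hE0 : (0 : ℝ) < (E : ℝ) := by exact_mod_cast absRamificationIdx_pos p (RescaledCompletion K p v hv)
  have hE2r : (2 : ℝ) ≤ (E : ℝ) := by exact_mod_cast he2
  have hEz : (0 : ℤ) < (E : ℤ) := by exact_mod_cast absRamificationIdx_pos p (RescaledCompletion K p v hv)
  have hnp : ∀ q : ℤ, ‖(p : ℚ_[p]) ^ q‖ = (p : ℝ) ^ (-(q : ℝ)) := fun q => by
    rw [norm_zpow, Padic.norm_p, inv_zpow', ← Real.rpow_intCast, Int.cast_neg]
  set q : ℤ := t / (E : ℤ) with hq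
  set r : ℤ := t % (E : ℤ) with hr
  have hr0 : 0 ≤ r := Int.emod_nonneg _ hEz.ne'
  have hrE : r < E := Int.emod_lt_of_pos _ hEz
  have htqr : (t : ℝ) = (E : ℝ) * q + r := by
    have h1 : t = (E : ℤ) * q + r := by rw [hr, hq, Int.emod_def]; ring
    exact_mod_cast h1
  have htE : (t : ℝ) / (E : ℝ) = q + (r : ℝ) / (E : ℝ) := by rw [htqr]; field_simp
  have htE0 : r = 0 → (t : ℝ) / (E : ℝ) = q := fun h0 => by simp [htE, h0]
  have hgain0 : (0 : ℝ) ≤ 1 - 1 / (E : ℝ) - (if bit then 0 else 1 / (E : ℝ)) := by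
    have h2 : (1 : ℝ) / (E : ℝ) ≤ 1 / 2 := one_div_le_one_div_of_le (by norm_num) hE2r
    split_ifs <;> linarith
  by_cases hdiv : r = 0
  · by_cases hb : bit
    · -- `e ∣ t`, the bit may hold: the log-shell ball `p^{q−1}·log_p`, radius `p^{−q+1−1/E}`
      refine ⟨‖(p : ℚ_[p]) ^ (q - 1)‖ * (p : ℝ) ^ (-(1 / (E : ℝ))), ?_, fun δ hδ y hy => ?_, ?_⟩
      · rw [hnp, ← Real.rpow_add hp0]
        refine Real.rpow_le_rpow_of_exponent_le hp1 ?_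
        rw [htE0 hdiv]
        have h3 : (1:ℝ) / E ≤ 1 := by rw [div_le_one hE0]; linarith
        push_cast; linarith
      · exact norm_of_apply_le_of_mem_closure_of_le p v hv hp2 he (zpow_ne_zero _ hpQ) hδ hy
      · rw [if_pos hb, hnp, ← Real.rpow_add hp0]
        refine Real.rpow_le_rpow_of_exponent_le hp1 ?_
        rw [htE0 hdiv]; push_cast; linarith
    · -- `e ∣ t`, the bit fails: the depth-`e` ball `p^{q−1}·p·𝒪`, radius `p^{−q}`, strip-INVARIANT
      refine ⟨‖(p : ℚ_[p]) ^ (q - 1)‖ * (p : ℝ)⁻¹, ?_, fun δ hδ y hy => ?_, ?_⟩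
      · rw [hnp, ← Real.rpow_neg_one, ← Real.rpow_add hp0]
        refine Real.rpow_le_rpow_of_exponent_le hp1 ?_
        rw [htE0 hdiv]; push_cast; linarith
      · have hM := image_depthE_ball_eq_of_mem_closure_of_fixesBaseLine v p hv hp2 he hf (zpow_ne_zero (q - 1) hpQ) (hfix hb) hδ
        have h1 : δ y ∈ δ '' {x | ‖RescaledCompletion.of K p v hv x‖ ≤ ‖(p : ℚ_[p]) ^ (q - 1)‖ * (p : ℝ)⁻¹} := ⟨y, hy, rfl⟩
        rw [hM] at h1
        exact h1
      · rw [if_neg hb, hnp, ← Real.rpow_neg_one, ← Real.rpow_add hp0]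
        refine Real.rpow_le_rpow_of_exponent_le hp1 ?_
        rw [htE0 hdiv]
        have : (0 : ℝ) ≤ 1 - 2 / (E : ℝ) := by
          rw [sub_nonneg, div_le_one hE0]; exact hE2r
        have h4 : (1 : ℝ) - 1 / (E : ℝ) - 1 / (E : ℝ) = 1 - 2 / (E : ℝ) := by ring
        push_cast; linarith
  · -- `e ∤ t`: the log-shell ball `p^{q}·log_p`, radius `p^{−q−1/E}`
    have hr1 : 1 ≤ r := by omega
    have hr1' : (1 : ℝ) ≤ (r : ℝ) := by exact_mod_cast hr1
    have hrE' : (r : ℝ) ≤ (E : ℝ) - 1 := by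
      have : r ≤ (E : ℤ) - 1 := by omega
      exact_mod_cast this
    refine ⟨‖(p : ℚ_[p]) ^ q‖ * (p : ℝ) ^ (-(1 / (E : ℝ))), ?_, fun δ hδ y hy => ?_, ?_⟩
    · rw [hnp, ← Real.rpow_add hp0]
      refine Real.rpow_le_rpow_of_exponent_le hp1 ?_
      rw [htE]
      have : (1 : ℝ) / (E : ℝ) ≤ (r : ℝ) / (E : ℝ) := div_le_div_of_nonneg_right hr1' hE0.le
      linarith
    · exact norm_of_apply_le_of_mem_closure_of_le p v hv hp2 he (zpow_ne_zero _ hpQ) hδ hy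
    · rw [hnp, ← Real.rpow_add hp0]
      refine Real.rpow_le_rpow_of_exponent_le hp1 ?_
      rw [htE]
      have h1 : (r : ℝ) / (E : ℝ) ≤ 1 - 1 / (E : ℝ) := by
        rw [div_le_iff₀ hE0, sub_mul, one_mul, div_mul_cancel₀ _ hE0.ne']; linarith
      have h2 : (0 : ℝ) ≤ 1 / (E : ℝ) - (if bit then 0 else 1 / (E : ℝ)) := by
        split_ifs
        · rw [sub_zero]; positivity
        · rw [sub_self]
      linarith

/-! ## §2 Any number of factors: confinement of the orbit of the Θ-region by the monomial box -/

section Packet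

variable {I : Type} [Fintype I] [DecidableEq I] (w : I → HeightOneSpectrum (𝓞 K)) (hw : ∀ i, ((p : ℕ) : 𝓞 K) ∈ (w i).asIdeal)

/-- **CONFINEMENT OF THE Θ-REGION's ORBIT BY THE MONOMIAL BOX (UNCONDITIONAL, any number of factors).**  Genuine packet, every factor tame of residue degree one
with `e_i ≥ 2`; `‖g‖ = p^{−v/E}`; bits may hold only on `S` (off `S`: `hfix`); `H` factorwise through the realised strip groups.  Then the `(R_I)^∼`-hull of the `H`-orbit
of `ι_{i₀}(g)·(R_I)^∼` lies in the polydisc of radius `R′_S = ∏_i p^{−[i=i₀]·v/e_i + 1 − 1/e_i − [i∉S]/e_i}` `= p^{−v/E}·∏_{i∈S} p^{1−1/e_i}·∏_{i∉S} p^{1−2/e_i}`: write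
`z = ι_{i₀}(g)·y`, `y = Σ_J y_J ⊗_i π_i^{J_i}` in the power bases of radical uniformisers (κ1) with `‖y_J‖·∏ p^{−J_i/e_i} ≤ 1` (κ2, `(R_I)^∼` = Box); each
`γ(⊗u_J)`, `u_J = (π_i^{J_i})[i₀ ↦ g·π_{i₀}^{J_{i₀}}]`, is a pure tensor with factor norms `≤ ρ_{J,i}` (§1, exponent `t = J_i + [i=i₀]·v`), and
`∏_i ρ_{J,i} ≤ (∏_i p^{−J_i/e_i})·R′_S`; ultrametric sum over `J`. [claim: Mochizuki2012, status: disputed]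
[cite: Mochizuki2012, IUTchIII Thm. 3.11 (i) p. 154; Rmk. 3.9.5 (i) p. 127; IUTchIV Prop. 1.1 p. 9, Prop. 1.2 (ii) p. 10] [cite: DupuyHilado2025, §4.9, §4.12] -/
theorem packetHull_orbit_smul_normalizedPacket_subset_polydisc_of_fixesBaseLine_off (hp2 : 2 < p)
    (he : ∀ i, absRamificationIdx p (RescaledCompletion K p (w i) (hw i)) ≤ p - 2)
    (he2 : ∀ i, 2 ≤ absRamificationIdx p (RescaledCompletion K p (w i) (hw i))) (hf : ∀ i, (w i).asIdeal.inertiaDeg ℤ = 1)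
    (i₀ : I) {g : RescaledCompletion K p (w i₀) (hw i₀)} {v : ℤ}
    (hv : ‖g‖ = (p : ℝ) ^ (-(v / (absRamificationIdx p (RescaledCompletion K p (w i₀) (hw i₀)) : ℝ))))
    (S : Finset I)
    (hfix : ∀ i, i ∉ S → ∀ ψ ∈ ind1StripOf (w i) (galoisLog (w i)),
      RescaledCompletion.of K p (w i) (hw i) (ψ (p : (w i).adicCompletion K)) - (p : RescaledCompletion K p (w i) (hw i)) ∈
        (p : ℚ_[p]) • logUnits (RescaledCompletion K p (w i) (hw i)))
    (H : Subgroup (PacketAlgebra p (fun i => RescaledCompletion K p (w i) (hw i)) ≃ₗ[ℚ_[p]]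
      PacketAlgebra p (fun i => RescaledCompletion K p (w i) (hw i))))
    (hHfac : ∀ γ ∈ H, ∃ δ : Π i, AddAut ((w i).adicCompletion K),
      (∀ i, δ i ∈ AddSubgroup.closure (G := AddAut ((w i).adicCompletion K)) (ind1StripOf (w i) (galoisLog (w i)))) ∧
      ∀ z : Π i, RescaledCompletion K p (w i) (hw i),
        γ (PiTensorProduct.tprod ℚ_[p] z) =
          PiTensorProduct.tprod ℚ_[p] (fun i => RescaledCompletion.of K p (w i) (hw i)
            (δ i ((RescaledCompletion.of K p (w i) (hw i)).symm (z i))))) :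
    packetHull p (fun i => RescaledCompletion K p (w i) (hw i))
        (⋃ γ : H, (γ : PacketAlgebra p (fun i => RescaledCompletion K p (w i) (hw i)) ≃ₗ[ℚ_[p]]
            PacketAlgebra p (fun i => RescaledCompletion K p (w i) (hw i))) ''
          (iota p (fun i => RescaledCompletion K p (w i) (hw i)) i₀ g •
            (normalizedPacket p (fun i => RescaledCompletion K p (w i) (hw i)) :
              Set (PacketAlgebra p (fun i => RescaledCompletion K p (w i) (hw i)))))) ⊆
      dEquiv p (fun i => RescaledCompletion K p (w i) (hw i)) ⁻¹'
        polydisc (DFac p (fun i => RescaledCompletion K p (w i) (hw i))) (fun _ =>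
          ∏ i, (p : ℝ) ^ (-(if i = i₀ then (v : ℝ) else 0) / (absRamificationIdx p (RescaledCompletion K p (w i) (hw i)) : ℝ) +
            (1 - 1 / (absRamificationIdx p (RescaledCompletion K p (w i) (hw i)) : ℝ) -
              if i ∈ S then 0 else 1 / (absRamificationIdx p (RescaledCompletion K p (w i) (hw i)) : ℝ)))) := by
  classical
  set k := fun i => RescaledCompletion K p (w i) (hw i) with hk
  set em := fun i => RescaledCompletion.of K p (w i) (hw i) with hem_def
  haveI : Nonempty I := ⟨i₀⟩
  have hP : p.Prime := Fact.out
  have hp0 : (0 : ℝ) < p := by exact_mod_cast hP.pos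
  have hei0 : ∀ i, (0 : ℝ) < (absRamificationIdx p (k i) : ℝ) := fun i => by exact_mod_cast absRamificationIdx_pos p (k i)
  -- gains and the target radius
  let gain : I → ℝ := fun i => 1 - 1 / (absRamificationIdx p (k i) : ℝ) - if i ∈ S then 0 else 1 / (absRamificationIdx p (k i) : ℝ)
  let sh : I → ℝ := fun i => if i = i₀ then (v : ℝ) else 0
  set R' : ℝ := ∏ i, (p : ℝ) ^ (-(sh i) / (absRamificationIdx p (k i) : ℝ) + gain i) with hR'
  have hR'0 : 0 ≤ R' := Finset.prod_nonneg fun i _ => (Real.rpow_pos_of_pos hp0 _).le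
  -- (κ1) radical uniformisers and their power bases; `[K_{w_i} : ℚ_p] = e_i`
  have hpe : ∀ i, ¬ p ∣ absRamificationIdx p (k i) := fun i hd => by
    have h1 := Nat.le_of_dvd (absRamificationIdx_pos p (k i)) hd
    have h2 : absRamificationIdx p (k i) ≤ p - 2 := he i
    have h3 := hP.two_le; omega
  have hres : ∀ i, residueDegree p (k i) = 1 := fun i => by
    change residueDegree p (RescaledCompletion K p (w i) (hw i)) = 1
    rw [residueDegree_rescaledCompletion]; exact hf i
  have hfr : ∀ i, Module.finrank ℚ_[p] (k i) = absRamificationIdx p (k i) := fun i => by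
    have h := absRamificationIdx_mul_residueDegree p (k i)
    rw [hres i, mul_one] at h
    exact h.symm
  have hrad : ∀ i, ∃ π : k i, ‖π‖ = (p : ℝ) ^ (-(1 / (absRamificationIdx p (k i) : ℝ))) ∧
      ∃ m : ℕ, 0 < m ∧ m < p ∧ π ^ absRamificationIdx p (k i) = (m : k i) * (p : k i) :=
    fun i => Radical.exists_norm_eq_and_pow_eq_natCast_mul p (k i) (hpe i) (hres i)
  choose π hπn m hm0 hmp hπe using hrad
  have hbex : ∀ i, ∃ b : Basis (Fin (Module.finrank ℚ_[p] (k i))) ℚ_[p] (k i), ∀ j, b j = π i ^ (j : ℕ) := fun i =>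
    MonomialBox.exists_basis_eq_pow (p := p) (by
      rw [hfr i, hπn i, ← Real.rpow_natCast, ← Real.rpow_mul hp0.le, ← Real.rpow_neg_one]
      congr 1; field_simp [(hei0 i).ne'])
  choose b hb using hbex
  have hnb : ∀ i (j : Fin (Module.finrank ℚ_[p] (k i))), ‖b i j‖ = (p : ℝ) ^ (-((j : ℕ) : ℝ) / (absRamificationIdx p (k i) : ℝ)) := by
    intro i j
    rw [hb, norm_pow, hπn, ← Real.rpow_natCast, ← Real.rpow_mul hp0.le]
    congr 1; ring
  -- (κ2) the box: coordinates of `(R_I)^∼` in the tensor power basis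
  have hbox : ∀ y ∈ normalizedPacket p k, ∀ J : Π i, Fin (Module.finrank ℚ_[p] (k i)),
      ‖(Basis.piTensorProduct b).repr y J‖ * ∏ i, ‖b i (J i)‖ ≤ 1 := fun y hy J =>
    MonomialBox.box_of_mem_normalizedPacket_of_radical p k (fun i => Module.finrank ℚ_[p] (k i)) b π
      (fun i => ((m i : ℚ_[p]) * p)) (fun i => by rw [hfr]; exact absRamificationIdx_pos p (k i)) (fun i => by rw [hfr]; exact hpe i) hb
      (fun i => by rw [hfr, hπe, map_mul, map_natCast, map_natCast]) hy J
  -- (§1) strip-stable radii for every factor and exponent, `t = j + [i = i₀]·v`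
  let tt : (i : I) → Fin (Module.finrank ℚ_[p] (k i)) → ℤ := fun i j => ((j : ℕ) : ℤ) + (if i = i₀ then v else 0)
  have htcast : ∀ i (j : Fin (Module.finrank ℚ_[p] (k i))), ((tt i j : ℤ) : ℝ) = ((j : ℕ) : ℝ) + sh i := by
    intro i j; simp only [tt, sh]; split_ifs <;> push_cast <;> ring
  have hρex : ∀ i (j : Fin (Module.finrank ℚ_[p] (k i))), ∃ ρ : ℝ,
      (p : ℝ) ^ (-(((tt i j : ℤ) : ℝ) / (absRamificationIdx p (k i) : ℝ))) ≤ ρ ∧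
      (∀ δ ∈ AddSubgroup.closure (G := AddAut ((w i).adicCompletion K)) (ind1StripOf (w i) (galoisLog (w i))),
        ∀ y : (w i).adicCompletion K, ‖em i y‖ ≤ ρ → ‖em i (δ y)‖ ≤ ρ) ∧
      ρ ≤ (p : ℝ) ^ (-(((tt i j : ℤ) : ℝ) / (absRamificationIdx p (k i) : ℝ)) + gain i) :=
    fun i j => exists_stableRadius p (w i) (hw i) hp2 (he i) (he2 i) (hf i) (i ∈ S) (fun hni => hfix i hni) (tt i j)
  choose ρ hρlo hρst hρhi using hρex
  have hρ0 : ∀ i j, 0 ≤ ρ i j := fun i j => (Real.rpow_pos_of_pos hp0 _).le.trans (hρlo i j)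
  -- the exponent bookkeeping: `p^{−t/e} = ‖b_i j‖·p^{−sh_i/e_i}`
  have hsplit : ∀ i (j : Fin (Module.finrank ℚ_[p] (k i))) (x : ℝ),
      (p : ℝ) ^ (-(((tt i j : ℤ) : ℝ) / (absRamificationIdx p (k i) : ℝ)) + x) =
        ‖b i j‖ * (p : ℝ) ^ (-(sh i) / (absRamificationIdx p (k i) : ℝ) + x) := by
    intro i j x
    rw [hnb, ← Real.rpow_add hp0, htcast]
    congr 1
    ring
  -- the orbit bound
  set O := ⋃ γ : H, (γ : PacketAlgebra p k ≃ₗ[ℚ_[p]] PacketAlgebra p k) ''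
    (iota p k i₀ g • (normalizedPacket p k : Set (PacketAlgebra p k))) with hO
  have hOle : ∀ y' ∈ O, ∀ jj, ‖dEquiv p k y' jj‖ ≤ R' := by
    intro y' hy' jj
    obtain ⟨γ, hy''⟩ := Set.mem_iUnion.mp hy'
    obtain ⟨z, hz, rfl⟩ := hy''
    obtain ⟨y, hy, rfl⟩ := Set.mem_smul_set.mp hz
    obtain ⟨δ, hδ, hγz⟩ := hHfac γ γ.2
    -- expansion of `ι(g)·y` along the tensor power basis and the image under `γ`
    set c : (Π i, Fin (Module.finrank ℚ_[p] (k i))) → ℚ_[p] := fun J => (Basis.piTensorProduct b).repr y J with hc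
    let u : (Π i, Fin (Module.finrank ℚ_[p] (k i))) → Π i, k i := fun J => update (fun i => b i (J i)) i₀ (g * b i₀ (J i₀))
    have hexp : (γ : PacketAlgebra p k ≃ₗ[ℚ_[p]] PacketAlgebra p k) (iota p k i₀ g • y) =
        ∑ J, c J • PiTensorProduct.tprod ℚ_[p] (fun i => em i (δ i ((em i).symm (u J i)))) := by
      conv_lhs => rw [← (Basis.piTensorProduct b).sum_repr y, smul_eq_mul, Finset.mul_sum]
      rw [map_sum]
      refine Finset.sum_congr rfl fun J _ => ?_
      rw [mul_smul_comm, map_smul, Basis.piTensorProduct_apply, ← purePacket, iota_mul_purePacket]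
      exact congrArg _ (hγz (u J))
    -- norm of each term
    have hterm : ∀ J, ‖c J • dEquiv p k (PiTensorProduct.tprod ℚ_[p] (fun i => em i (δ i ((em i).symm (u J i))))) jj‖ ≤ R' := by
      intro J
      have hcomp : ‖dEquiv p k (PiTensorProduct.tprod ℚ_[p] (fun i => em i (δ i ((em i).symm (u J i))))) jj‖ =
          ∏ i, ‖em i (δ i ((em i).symm (u J i)))‖ := by
        have h1 := psi_purePacket_apply p k (DFac p k) (dEquiv p k) (fun i => em i (δ i ((em i).symm (u J i)))) jj
        simp only [purePacket] at h1
        rw [h1, norm_prod]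
        exact Finset.prod_congr rfl fun i _ => norm_factorEmb p k (DFac p k) (dEquiv p k) i jj _
      have hfac : ∀ i, ‖em i (δ i ((em i).symm (u J i)))‖ ≤ ρ i (J i) := by
        intro i
        refine hρst i (J i) _ (hδ i) _ ?_
        rw [(em i).apply_symm_apply]
        refine le_trans (le_of_eq ?_) (hρlo i (J i))
        rw [htcast]
        by_cases hi : i = i₀
        · subst hi
          simp only [u, update_self, sh, if_pos rfl]
          rw [norm_mul, hv, hnb, ← Real.rpow_add hp0]
          congr 1
          ring
        · simp only [u, update_of_ne hi, sh, if_neg hi]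
          rw [hnb]
          congr 1
          ring
      rw [norm_smul, hcomp]
      calc ‖c J‖ * ∏ i, ‖em i (δ i ((em i).symm (u J i)))‖
          ≤ ‖c J‖ * ∏ i, ρ i (J i) := mul_le_mul_of_nonneg_left (Finset.prod_le_prod (fun i _ => norm_nonneg _) fun i _ => hfac i) (norm_nonneg _)
        _ ≤ ‖c J‖ * ∏ i, (‖b i (J i)‖ * (p : ℝ) ^ (-(sh i) / (absRamificationIdx p (k i) : ℝ) + gain i)) :=
          mul_le_mul_of_nonneg_left (Finset.prod_le_prod (fun i _ => hρ0 i _) fun i _ => by rw [← hsplit]; exact hρhi i (J i)) (norm_nonneg _)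
        _ = (‖c J‖ * ∏ i, ‖b i (J i)‖) * R' := by rw [Finset.prod_mul_distrib, hR', mul_assoc]
        _ ≤ 1 * R' := mul_le_mul_of_nonneg_right (hbox y hy J) hR'0
        _ = R' := one_mul _
    change ‖dEquiv p k ((γ : PacketAlgebra p k ≃ₗ[ℚ_[p]] PacketAlgebra p k) (iota p k i₀ g • y)) jj‖ ≤ R'
    rw [hexp, map_sum, Finset.sum_apply]
    refine IsUltrametricDist.norm_sum_le_of_forall_le_of_nonneg hR'0 fun J _ => ?_
    rw [map_smul, Pi.smul_apply]
    exact hterm J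
  -- hull of a bounded set
  have hObdd : IsBounded (dEquiv p k '' O) := by
    refine (isBounded_polydisc (DFac p k) (fun _ => R')).subset ?_
    rintro _ ⟨y, hy, rfl⟩
    exact (mem_polydisc (DFac p k)).mpr (hOle y hy)
  have hrad : ∀ jj, hullRadius (DFac p k) (dEquiv p k '' O) jj ≤ R' := fun jj =>
    hullRadius_le_of_nonneg (DFac p k) hR'0 (by rintro _ ⟨y, hy, rfl⟩; exact hOle y hy jj)
  intro y hy
  rw [packetHull_eq_preimage_holomorphicHull p k (DFac p k) (dEquiv p k) hObdd, Set.mem_preimage,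
    holomorphicHull_of_isBounded (DFac p k) hObdd, mem_polydisc] at hy
  exact (mem_polydisc (DFac p k)).mpr fun jj => (hy jj).trans (hrad jj)

end Packet

end Summit.ABC.IUTFork.Thm311.Real
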